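import Mathlib
import Summits.MatrixMultiplication.Statement
import Summits.MatrixMultiplication.MatrixMultiplication.Theorems.GraphEquationsCompressedPowers
import Summits.MatrixMultiplication.MatrixMultiplication.Theorems.GraphEquationsHorizontalDerivation

/-!
# One horizontal round does what `D − 2` vertical rounds cannot (`GraphEquations`, lens 5, g49, M83)

Helper for `Summit.MatrixMultiplication.MatrixMultiplication.Theses.GraphEquations.MultiplicityReduction`
(stmt-MatrixMultiplication-27806); decomp-mm node «GraphEquations»; target of the node, VERBATIM:
`_root_.MatrixMultiplication`.  Rung currency `0` (a calibration of the deflation dials, not a rung).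

## The question decided here (NODE-g49 §2, «is the height law of record vertical-only?»)

M79 (`GraphEquationsKernelTowers`) typed KERNEL TOWERS — words of VERTICAL derivations `D_μ`, `μ` a kernel
field of the stage before it — and M82 (`GraphEquationsCompressedPowers`) proved with the compressed powers
`CP_e` (`e = D − 1`) that at degree `D ≥ 4` no kernel tower of height `≤ D − 3` is ideal-initially isolating to
order `1` over any base pair (`not_towerReach_order_one`, the «height law» `h₁(D) ≥ D − 2` of NODE-g48 §7).
The HORIZONTAL derivations `X_{U,V} = Σ U ∂_a + Σ V ∂_b + Σ (Ub + aV) ∂_c` of M60a (`hDer`; tangent to the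
graph, `hDer_generator`; AFFINE values on variables, `hDer_affine`, so forward differentiation along them is
free in the Ostrowski currency and costs `≤ 4·cost + O(n²)` gates for a diagonal `U`) are NOT letters of that
alphabet.  This file decides what they do to the SAME witnesses:

* `hDer_cpSlave`: `X_{U,V} σ_i = (Ub + aV)_B · f_{i-1}` — the horizontal derivative of the slave
  `σ_i = f_i + (ab)_B f_{i-1}` EXPOSES `f_{i-1}` wherever the scalar `(UB + AV)_B` is nonzero;
* `cp_hDer_order_one`: over every base pair `y` with `(UB + AV)_B(y) ≠ 0` the set
  `T(CP_e) ∪ X_{U,V} T(CP_e)` is ideal-initially isolated to ORDER `1` (the members `X σ_1, …, X σ_{e-1}`,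
  `σ_{e-1}` and the plain generators have `F`-linear initial forms `βF_0, …, βF_{e-2}`, `F_{e-1} + αF_{e-2}`,
  `F_q` with only the trivial common zero);
* `exists_cp_horizontal`: the realised systems — `E = CP_e` (correct, degree `≤ e + 1`, NO kernel tower of height
  `r` with `r + K < e` isolating to order `K` anywhere, M82) and `E' = E ⧺ (X σ_i)_i` (correct, degree `≤ e + 1`,
  tests inside `T(E) ∪ X T(E)`, ideal-initially isolated to order `1` and hence REDUCED at the graph point over
  every base pair with `(UB + AV)_B ≠ 0`);
* `horizontal_round_vs_towers`: for every `D ≥ 4`, over `n = D − 1`, with the FREE direction `U = 1`, `V = 0`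
  (`(1·B + A·0)_B = B_B`): a correct degree-`≤ D` system on which every kernel tower of height `≤ D − 3` fails
  order `1` over every base pair, while ONE horizontal round yields a correct degree-`≤ D` GENERICALLY REDUCED
  system.

So the law `r + K ≥ D − 1` of M82 is a law of the VERTICAL alphabet: in the mixed alphabet
{`D_μ`} ∪ {`X_{U,V}`} the witnesses `CP_e` have height `1` uniformly in `D` (NODE-g49 §2–§3: every specimen of
the lens-5 zoo has free mixed height `1`; the cost question starts only at specimens that defeat the free
letters).  No new dial is typed here.  No `sorry`.

Sources: Leykin–Verschelde–Zhao, TCS 359 (2006) [doi:10.1016/j.tcs.2006.02.018] (deflation);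
[BurgisserClausenShokrollahi1997, §7.1 (Baur–Strassen), Problem 16.3]; M60a `GraphEquationsHorizontalDerivation`,
M79 `GraphEquationsKernelTowers`, M82 `GraphEquationsCompressedPowers` (this tree).
-/

set_option linter.dupNamespace false

noncomputable section

namespace Summit.MatrixMultiplication.MatrixMultiplication.Theorems.GraphEquations

open MvPolynomial Matrix Literature.Computability.AlgebraicComplexity Literature.Computability.AlgebraicComplexity.ArithCircuit

variable {n : ℕ}

/-! ## The scalar `(Ub + aV)_q` as a base polynomial -/

/-- `(Ub + aV)_q = Σ_k (U_{q₁k} b_{kq₂} + a_{q₁k} V_{kq₂})` as an (affine-linear) polynomial in the BASE variables. -/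
def abDer (U V : Vec n) (q : Fin n × Fin n) : MvPolynomial (MatMulVars n) ℂ :=
  ∑ k : Fin n, (C (U (q.1, k)) * X (Sum.inr (k, q.2)) + X (Sum.inl (q.1, k)) * C (V (k, q.2)))

/-- `ι((Ub + aV)_q)` is the value of the horizontal field on `c_q`. -/
theorem liftAB_abDer (U V : Vec n) (q : Fin n × Fin n) : liftAB n (abDer U V q) = hField U V (Sum.inr q) := by
  simp only [abDer, hField, map_sum, map_add, map_mul, liftAB_C, liftAB_X, aVar, bVar]

/-- **`X_{U,V} (ab)_q = (Ub + aV)_q`.** -/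
theorem hDer_liftAB_abBase (U V : Vec n) (q : Fin n × Fin n) :
    hDer U V (liftAB n (abBase n q)) = liftAB n (abDer U V q) := by
  rw [liftAB_abBase, map_sub, hDer_generator, sub_zero, hDer_X, liftAB_abDer]

/-- The value of `(Ub + aV)_q` at the base pair `y = (A, B)`. -/
theorem eval_abDer (U V : Vec n) (q : Fin n × Fin n) (y : MatMulVars n → ℂ) :
    eval y (abDer U V q) = ∑ k : Fin n, (U (q.1, k) * y (Sum.inr (k, q.2)) + y (Sum.inl (q.1, k)) * V (k, q.2)) := by
  simp only [abDer, map_sum, map_add, map_mul, eval_C, eval_X]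

/-- The FREE direction `U = 1` (identity matrix), `V = 0`: `(1·b + a·0)_q = b_q`. -/
def diagOne (n : ℕ) : Vec n := fun v => if v.1 = v.2 then 1 else 0

/-- At `U = 1`, `V = 0` the scalar is the variable `b_q` itself: its value at `y` is `y(b_q)`. -/
theorem eval_abDer_diagOne (q : Fin n × Fin n) (y : MatMulVars n → ℂ) :
    eval y (abDer (diagOne n) 0 q) = y (Sum.inr q) := by
  rw [eval_abDer, Finset.sum_eq_single q.1]
  · simp [diagOne]
  · intro k _ hk
    simp [diagOne, Ne.symm hk]
  · intro h; exact absurd (Finset.mem_univ _) h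

/-- `X_{U,V}` maps the graph ideal into itself (it kills the generators). -/
theorem hDer_mem_graphIdeal (U V : Vec n) {t : MvPolynomial (GraphVars n) ℂ} (ht : t ∈ graphIdeal n) :
    hDer U V t ∈ graphIdeal n :=
  Derivation.apply_mem_graphIdeal (hDer U V) (hDer_generator U V) ht

section CompressedPower

variable (d : ℕ) (hd : d + 3 ≤ n)

/-! ## The horizontal derivative of the slaves -/

/-- **`X_{U,V} σ_i = (Ub + aV)_B · f_{i-1}`**: the horizontal derivative of a slave is the scalar polynomial
`ι((Ub + aV)_B)` times the PREVIOUS generator of the chain. -/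
theorem hDer_cpSlave (U V : Vec n) (i : ℕ) :
    hDer U V (cpSlave d hd i) = liftAB n (abDer U V (cpPos d hd 0)) * cpGen d hd (i - 1) := by
  unfold cpSlave
  rw [map_add, cpGen, hDer_generator, zero_add, Derivation.leibniz, cpGen, hDer_generator, smul_zero, zero_add,
    cpW_eq, hDer_liftAB_abBase, smul_eq_mul, mul_comm]

/-- The horizontal derivative of a slave lies in `I(Γ)`. -/
theorem hDer_cpSlave_mem_graphIdeal (U V : Vec n) (i : ℕ) : hDer U V (cpSlave d hd i) ∈ graphIdeal n := by
  rw [hDer_cpSlave]; exact Ideal.mul_mem_left _ _ (generator_mem_graphIdeal _)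

/-- `(Ub + aV)_q` has degree `≤ 1`. -/
theorem totalDegree_abDer_le (U V : Vec n) (q : Fin n × Fin n) : (liftAB n (abDer U V q)).totalDegree ≤ 1 := by
  rw [liftAB_abDer]
  unfold hField
  refine (totalDegree_finsetSum _ _).trans (Finset.sup_le fun k _ => (totalDegree_add _ _).trans (max_le ?_ ?_))
  · exact (totalDegree_mul _ _).trans (by rw [totalDegree_C, zero_add]; exact (totalDegree_X _).le)
  · exact (totalDegree_mul _ _).trans (by rw [totalDegree_C, add_zero]; exact (totalDegree_X _).le)

/-- The horizontal derivative of a slave has degree `≤ 3`. -/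
theorem totalDegree_hDer_cpSlave_le (U V : Vec n) (i : ℕ) : (hDer U V (cpSlave d hd i)).totalDegree ≤ 3 := by
  rw [hDer_cpSlave]
  exact (totalDegree_mul _ _).trans (by
    have h1 := totalDegree_abDer_le U V (cpPos d hd 0)
    have h2 := totalDegree_generator_le_two n (cpPos d hd (i - 1))
    unfold cpGen; omega)

/-! ## Order one after one horizontal round -/

/-- The isolating family, indexed by positions: at a chain position `(i,0)` with `i ≤ d + 1` the horizontal
derivative `X σ_{i+1}`, at `(d+2, 0)` the slave `σ_{d+2}` itself, elsewhere the plain generator. -/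
def cpHFam (U V : Vec n) (q : Fin n × Fin n) : MvPolynomial (GraphVars n) ℂ :=
  if (q.2 : ℕ) = 0 ∧ (q.1 : ℕ) < d + 3 then
    (if (q.1 : ℕ) = d + 2 then cpSlave d hd (d + 2) else hDer U V (cpSlave d hd ((q.1 : ℕ) + 1)))
  else generator n q

/-- Its fibre coordinates: `βF_i`, `F_{d+2} + αF_{d+1}`, `F_q` (`β = (Ub+aV)_B`, `α = (ab)_B`). -/
def cpHForm (U V : Vec n) (q : Fin n × Fin n) : FPoly n :=
  if (q.2 : ℕ) = 0 ∧ (q.1 : ℕ) < d + 3 then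
    (if (q.1 : ℕ) = d + 2 then X (cpPos d hd (d + 2)) + C (abBase n (cpPos d hd 0)) * X (cpPos d hd (d + 1))
      else C (abDer U V (cpPos d hd 0)) * X q)
  else X q

/-- `substF` of the forms gives the family. -/
theorem substF_cpHForm (U V : Vec n) (q : Fin n × Fin n) : substF n (cpHForm d hd U V q) = cpHFam d hd U V q := by
  unfold cpHForm cpHFam
  split_ifs with hq hlast
  · unfold cpSlave
    rw [map_add, map_mul, substF_X, substF_C, substF_X, cpW_eq, show d + 2 - 1 = d + 1 from rfl]; rfl
  · rw [map_mul, substF_C, substF_X, hDer_cpSlave, Nat.add_sub_cancel, cpGen, cpPos_eq d hd hq]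
  · rw [substF_X]

/-- The forms have no `F`-constant term. -/
theorem homogeneousComponent_zero_cpHForm (U V : Vec n) (q : Fin n × Fin n) :
    homogeneousComponent 0 (cpHForm d hd U V q) = 0 := by
  rw [homogeneousComponent_zero, ← constantCoeff_eq, C_eq_zero]
  unfold cpHForm
  split_ifs <;> simp [constantCoeff_X]

/-- The forms are `F`-linear. -/
theorem homogeneousComponent_one_cpHForm (U V : Vec n) (q : Fin n × Fin n) :
    homogeneousComponent 1 (cpHForm d hd U V q) = cpHForm d hd U V q := by
  unfold cpHForm
  split_ifs
  · rw [map_add, homogeneousComponent_one_X', homogeneousComponent_C_mul, homogeneousComponent_one_X']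
  · rw [homogeneousComponent_C_mul, homogeneousComponent_one_X']
  · rw [homogeneousComponent_one_X']

/-- Members of the family lie in the span of `T(CP_e) ∪ X_{U,V} T(CP_e)`. -/
theorem cpHFam_mem_span (U V : Vec n) (q : Fin n × Fin n) :
    cpHFam d hd U V q ∈ Ideal.span (Set.range (cpTest d hd) ∪ hDer U V '' Set.range (cpTest d hd)) := by
  unfold cpHFam
  split_ifs with hq hlast
  · exact Ideal.subset_span (Or.inl ⟨cpPos d hd (d + 2), cpTest_cpPos_of_pos d hd (by omega) le_rfl⟩)
  · refine Ideal.subset_span (Or.inr ⟨cpTest d hd (cpPos d hd ((q.1 : ℕ) + 1)), ⟨_, rfl⟩, ?_⟩)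
    rw [cpTest_cpPos_of_pos d hd (by omega) (by omega)]
  · refine Ideal.subset_span (Or.inl ⟨q, ?_⟩)
    unfold cpTest; rw [if_neg hq]

include hd in
/-- The family `(X σ_{i+1})_{i ≤ d+1}, σ_{d+2}, (f_q)_{q ∉ chain}` is initially isolating to order `1` over every base
pair `y` with `(UB + AV)_B(y) ≠ 0`. -/
theorem cpHFam_order_one (U V : Vec n) (y : MatMulVars n → ℂ) (hy : eval y (abDer U V (cpPos d hd 0)) ≠ 0) :
    IdealInitIsolatedSet (Set.range (cpHFam d hd U V)) 1 y := by
  classical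
  refine ⟨n * n, fun o => cpHFam d hd U V (chainPos n o), fun o => Ideal.subset_span ⟨_, rfl⟩, fun _ => 1,
    fun o => cpHForm d hd U V (chainPos n o), fun _ => le_rfl, fun o => substF_cpHForm d hd U V _, fun o j hj => ?_,
    fun F₀ hF => ?_⟩
  · have hj0 : j = 0 := by simp only at hj; omega
    subst hj0
    exact homogeneousComponent_zero_cpHForm d hd U V _
  · -- read the vanishing of the specialised linear forms position by position
    have hread : ∀ q : Fin n × Fin n,
        eval F₀ (map (eval y) (cpHForm d hd U V q)) = eval 0 (map (eval y) (cpHForm d hd U V q)) := fun q => by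
      obtain ⟨o, rfl⟩ := exists_chainPos_eq q
      have h := hF o
      simp only [homogeneousComponent_one_cpHForm] at h
      exact h
    -- off the chain: `F_q = 0`
    have hoff : ∀ q : Fin n × Fin n, ¬((q.2 : ℕ) = 0 ∧ (q.1 : ℕ) < d + 3) → F₀ q = 0 := fun q hq => by
      have h := hread q
      unfold cpHForm at h
      rw [if_neg hq] at h
      simpa using h
    -- on the chain below the top: `β·F_i = 0`, `β ≠ 0`
    have hlow : ∀ i, i < d + 2 → F₀ (cpPos d hd i) = 0 := fun i hi => by
      have hq : ((cpPos d hd i).2 : ℕ) = 0 ∧ ((cpPos d hd i).1 : ℕ) < d + 3 :=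
        ⟨cpPos_snd d hd i, by rw [cpPos_fst d hd (by omega)]; omega⟩
      have hne : ¬(((cpPos d hd i).1 : ℕ) = d + 2) := by rw [cpPos_fst d hd (by omega)]; omega
      have h := hread (cpPos d hd i)
      unfold cpHForm at h
      rw [if_pos hq, if_neg hne] at h
      simp only [map_mul, map_C, map_X, eval_C, eval_X, Pi.zero_apply, mul_zero] at h
      exact (mul_eq_zero.1 h).resolve_left hy
    -- the top of the chain: `F_{d+2} + α F_{d+1} = 0`
    have htop : F₀ (cpPos d hd (d + 2)) = 0 := by
      have hq : ((cpPos d hd (d + 2)).2 : ℕ) = 0 ∧ ((cpPos d hd (d + 2)).1 : ℕ) < d + 3 :=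
        ⟨cpPos_snd d hd _, by rw [cpPos_fst d hd (by omega)]; omega⟩
      have heq : ((cpPos d hd (d + 2)).1 : ℕ) = d + 2 := cpPos_fst d hd (by omega)
      have h := hread (cpPos d hd (d + 2))
      unfold cpHForm at h
      rw [if_pos hq, if_pos heq] at h
      simp only [map_add, map_mul, map_C, map_X, eval_C, eval_X, Pi.zero_apply, mul_zero, add_zero,
        hlow (d + 1) (by omega)] at h
      exact h
    funext q
    by_cases hq : (q.2 : ℕ) = 0 ∧ (q.1 : ℕ) < d + 3
    · rw [← cpPos_eq d hd hq]
      by_cases htq : (q.1 : ℕ) = d + 2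
      · rw [htq]; exact htop
      · exact hlow _ (by omega)
    · exact hoff q hq

include hd in
/-- **ONE HORIZONTAL ROUND REACHES ORDER ONE on `CP_e`**: over every base pair `y` with `(UB + AV)_B(y) ≠ 0`,
the ideal of `T(CP_e) ∪ X_{U,V} T(CP_e)` is initially isolated to order `1`. -/
theorem cp_hDer_order_one (U V : Vec n) (y : MatMulVars n → ℂ) (hy : eval y (abDer U V (cpPos d hd 0)) ≠ 0) :
    IdealInitIsolatedSet (Set.range (cpTest d hd) ∪ hDer U V '' Set.range (cpTest d hd)) 1 y :=
  (cpHFam_order_one d hd U V y hy).mono (Ideal.span_le.2 (by rintro _ ⟨q, rfl⟩; exact cpHFam_mem_span d hd U V q))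

/-! ## The realised systems -/

/-- `CP_e` tests lie in `I(Γ)`. -/
theorem cpTest_mem_graphIdeal (q : Fin n × Fin n) : cpTest d hd q ∈ graphIdeal n := by
  unfold cpTest
  split_ifs
  · unfold cpMain
    exact Ideal.sum_mem _ fun m _ =>
      Ideal.mul_mem_right _ _ (Ideal.mul_mem_right _ _ (generator_mem_graphIdeal _))
  · unfold cpSlave cpGen
    exact add_mem (generator_mem_graphIdeal _) (Ideal.mul_mem_left _ _ (generator_mem_graphIdeal _))
  · exact generator_mem_graphIdeal _

include hd in
/-- **`CP_e` and `CP_e` plus one horizontal round, realised.**  `E = CP_e`: correct, degree `≤ d + 4`, no kernel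
tower of height `r` with `K + r < d + 3` isolating to order `K` over any base pair (M82).  `E'`: correct, degree
`≤ d + 4`, `T(E) ⊆ T(E') ⊆ T(E) ∪ X_{U,V} T(E)`, and ideal-initially isolated to order `1` — hence REDUCED at the
graph point — over every base pair `y` with `(UB + AV)_B(y) ≠ 0`. -/
theorem exists_cp_horizontal (U V : Vec n) : ∃ E E' : EqSystem n,
    E.Correct ∧ E.IsDegLe (d + 4) ∧ E'.Correct ∧ E'.IsDegLe (d + 4) ∧
    E.testSet ⊆ E'.testSet ∧ E'.testSet ⊆ E.testSet ∪ hDer U V '' E.testSet ∧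
    (∀ μs : List (Fin n × Fin n → MvPolynomial (MatMulVars n) ℂ), IsKernelTower E.testSet μs →
      ∀ K, K + μs.length < d + 3 → ∀ y, ¬ IdealInitIsolatedSet (towerSet E.testSet μs) K y) ∧
    ∀ y, eval y (abDer U V (cpPos d hd 0)) ≠ 0 → E'.IdealInitIsolatedAt 1 y ∧ E'.ReducedAt (graphPoint y) := by
  classical
  -- `E = CP_e`
  obtain ⟨E, hfan, hto', hfrom'⟩ :=
    exists_realisation_list ((Finset.univ : Finset (Fin n × Fin n)).toList.map (cpTest d hd))
  have hto : ∀ o ∈ E.tests, ∃ q, E.testPoly o = cpTest d hd q := fun o ho =>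
    let ⟨q, _, hq⟩ := List.mem_map.1 (hto' o ho); ⟨q, hq.symm⟩
  have hS : E.testSet = Set.range (cpTest d hd) := Set.ext fun t => ⟨fun ht => by
    obtain ⟨o, ho, rfl⟩ := (E.mem_testSet_iff t).1 ht; obtain ⟨q, hq⟩ := hto o ho; exact ⟨q, hq.symm⟩, by
    rintro ⟨q, rfl⟩
    exact (E.mem_testSet_iff _).2 (hfrom' _ (List.mem_map_of_mem (Finset.mem_toList.2 (Finset.mem_univ q))))⟩
  have hE : E.Correct := by
    refine ⟨hfan, Set.ext fun x => ⟨fun hx => ?_, fun hx o ho => ?_⟩⟩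
    · exact (cpTest_zero_iff d hd x).1 fun q => by
        obtain ⟨o, ho, hq⟩ := (E.mem_testSet_iff _).1 (hS.ge (Set.mem_range_self q)); rw [← hq]; exact hx o ho
    · obtain ⟨q, hq⟩ := hto o ho; rw [hq]; exact (cpTest_zero_iff d hd x).2 hx q
  -- `E' = CP_e ⧺ (X σ_i)_{1 ≤ i ≤ d+2}`
  let extra : List (MvPolynomial (GraphVars n) ℂ) := (List.range (d + 2)).map fun i => hDer U V (cpSlave d hd (i + 1))
  obtain ⟨E', hfan', hto'', hfrom''⟩ :=
    exists_realisation_list ((Finset.univ : Finset (Fin n × Fin n)).toList.map (cpTest d hd) ++ extra)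
  have hmem' : ∀ o ∈ E'.tests, (∃ q, E'.testPoly o = cpTest d hd q) ∨ ∃ i, i < d + 2 ∧ E'.testPoly o = hDer U V (cpSlave d hd (i + 1)) :=
    fun o ho => by
    rcases List.mem_append.1 (hto'' o ho) with h | h
    · obtain ⟨q, _, hq⟩ := List.mem_map.1 h; exact Or.inl ⟨q, hq.symm⟩
    · obtain ⟨i, hi, hq⟩ := List.mem_map.1 h; exact Or.inr ⟨i, List.mem_range.1 hi, hq.symm⟩
  have hI' : ∀ o ∈ E'.tests, E'.testPoly o ∈ graphIdeal n := fun o ho => by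
    rcases hmem' o ho with ⟨q, hq⟩ | ⟨i, -, hq⟩
    · rw [hq]; exact cpTest_mem_graphIdeal d hd q
    · rw [hq]; exact hDer_cpSlave_mem_graphIdeal d hd U V _
  have hE' : E'.Correct := by
    refine ⟨hfan', Set.ext fun x => ⟨fun hx => ?_, fun hx o ho => ?_⟩⟩
    · exact (cpTest_zero_iff d hd x).1 fun q => by
        obtain ⟨o, ho, hq⟩ := hfrom'' _ (List.mem_append_left _
          (List.mem_map_of_mem (Finset.mem_toList.2 (Finset.mem_univ q))))
        rw [← hq]; exact hx o ho
    · exact eval_eq_zero_of_mem_graphIdeal (hI' o ho) hx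
  refine ⟨E, E', hE, fun o => ?_, hE', fun o => ?_, fun t ht => ?_, fun t ht => ?_, fun μs hT K hK y => ?_,
    fun y hy => ?_⟩
  · obtain ⟨q, hq⟩ := hto _ (List.get_mem _ o); rw [hq]; exact totalDegree_cpTest_le d hd q
  · rcases hmem' _ (List.get_mem _ o) with ⟨q, hq⟩ | ⟨i, -, hq⟩
    · rw [hq]; exact totalDegree_cpTest_le d hd q
    · rw [hq]; exact (totalDegree_hDer_cpSlave_le d hd U V _).trans (by omega)
  · rw [hS] at ht; obtain ⟨q, rfl⟩ := ht
    exact (E'.mem_testSet_iff _).2 (hfrom'' _ (List.mem_append_left _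
      (List.mem_map_of_mem (Finset.mem_toList.2 (Finset.mem_univ q)))))
  · obtain ⟨o, ho, rfl⟩ := (E'.mem_testSet_iff t).1 ht
    rw [hS]
    rcases hmem' o ho with ⟨q, hq⟩ | ⟨i, hi, hq⟩
    · exact Or.inl ⟨q, hq.symm⟩
    · refine Or.inr ⟨cpTest d hd (cpPos d hd (i + 1)), ⟨_, rfl⟩, ?_⟩
      rw [hq, cpTest_cpPos_of_pos d hd (by omega) (by omega)]
  · rw [hS] at hT ⊢; exact cp_tower d hd μs hT hK y
  · have hiso : E'.IdealInitIsolatedAt 1 y := by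
      refine (E'.idealInitIsolatedAt_iff 1 y).2 ((cpHFam_order_one d hd U V y hy).mono (Ideal.span_le.2 ?_))
      rintro _ ⟨q, rfl⟩
      show cpHFam d hd U V q ∈ Ideal.span E'.testSet
      unfold cpHFam
      split_ifs with hq hlast
      · refine Ideal.subset_span ((E'.mem_testSet_iff _).2 ?_)
        obtain ⟨o, ho, h⟩ := hfrom'' _ (List.mem_append_left extra
          (List.mem_map_of_mem (Finset.mem_toList.2 (Finset.mem_univ (cpPos d hd (d + 2))))))
        exact ⟨o, ho, h.trans (cpTest_cpPos_of_pos d hd (by omega) le_rfl)⟩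
      · refine Ideal.subset_span ((E'.mem_testSet_iff _).2 (hfrom'' _ (List.mem_append_right _ ?_)))
        exact List.mem_map.2 ⟨(q.1 : ℕ), List.mem_range.2 (by omega), rfl⟩
      · refine Ideal.subset_span ((E'.mem_testSet_iff _).2 ?_)
        obtain ⟨o, ho, h⟩ := hfrom'' _ (List.mem_append_left extra
          (List.mem_map_of_mem (Finset.mem_toList.2 (Finset.mem_univ q))))
        refine ⟨o, ho, h.trans ?_⟩
        unfold cpTest; rw [if_neg hq]
    exact ⟨hiso, EqSystem.reducedAt_of_idealInitIsolatedAt_one hE' hiso⟩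

end CompressedPower

/-- **ONE HORIZONTAL ROUND VERSUS `D − 2` VERTICAL ROUNDS.**  For every `D ≥ 4`, over `n = D − 1` and along the
FREE direction `U = 1`, `V = 0`: a correct degree-`≤ D` system `E` on which EVERY kernel tower of height `≤ D − 3`
fails order `1` over EVERY base pair (M82), together with a correct degree-`≤ D` system `E'`, whose tests lie in
`T(E) ∪ X_{1,0} T(E)`, that is GENERICALLY REDUCED (order `1` over the all-ones base pair).  The height law
`r + K ≥ D − 1` of `not_towerReach_of_add_le` is a law of the vertical alphabet only. -/
theorem horizontal_round_vs_towers {D : ℕ} (hD : 4 ≤ D) : ∃ E E' : EqSystem (D - 1),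
    E.Correct ∧ E.IsDegLe D ∧ E'.Correct ∧ E'.IsDegLe D ∧
    E.testSet ⊆ E'.testSet ∧ E'.testSet ⊆ E.testSet ∪ hDer (diagOne (D - 1)) 0 '' E.testSet ∧
    (∀ μs : List (Fin (D - 1) × Fin (D - 1) → MvPolynomial (MatMulVars (D - 1)) ℂ), IsKernelTower E.testSet μs →
      μs.length ≤ D - 3 → ∀ y, ¬ IdealInitIsolatedSet (towerSet E.testSet μs) 1 y) ∧
    E'.IdealInitIsolatedAt 1 (fun _ => 1) ∧ E'.GenericallyReduced := by
  obtain ⟨E, E', hE, hdeg, hE', hdeg', hsub, hsub', htow, hiso⟩ :=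
    exists_cp_horizontal (n := D - 1) (D - 4) (by omega) (diagOne (D - 1)) 0
  rw [show D - 4 + 4 = D by omega] at hdeg hdeg'
  have hy : eval (fun _ => (1 : ℂ)) (abDer (diagOne (D - 1)) 0 (cpPos (n := D - 1) (D - 4) (by omega) 0)) ≠ 0 := by
    rw [eval_abDer_diagOne]; exact one_ne_zero
  obtain ⟨h1, hred⟩ := hiso _ hy
  exact ⟨E, E', hE, hdeg, hE', hdeg', hsub, hsub', fun μs hT hlen y => htow μs hT 1 (by omega) y, h1,
    ⟨_, graphPoint_mem_mmGraph _, hred⟩⟩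

end Summit.MatrixMultiplication.MatrixMultiplication.Theorems.GraphEquations

end
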